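import Summits.ResolutionOfSingularities.ResolutionOfSingularities.Theorems.EquisingularLiftEquisingularLiftNatF102FibreTransport
import HarnessLib

/-!
# [OURS · L1 W4.5(b) · LINE (T-j)-PROOF · BRICK S5b (α′)] The constants of `ℙ¹_{k'}` come from `k`

Setting of res-L1-w45b-lead-2's F-102 skeleton (v3): a model square `(i, t)` over `θ : O ↠ k` (`O` local, `k` a field),
`e : C_k ≅ ℙ¹_{k'}`, and a section `s` of `f` through `i (e⁻¹ y_j)`.  Then on the chart `D₊(x_j)` every constant
`c' ∈ k'` is hit by `k` through `e⁻¹ ≫ t` (`exists_const_eq_awayToSection_cst`): the `k`-rational point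
`σ = (Spec θ ≫ s, 𝟙)` of `C_k` sits at `e⁻¹ y_j`, evaluation at `e σ` is a ring retraction `Γ(D₊(x_j)) → k` of
`ρ : k → Γ(D₊(x_j))`, injective on the constants `k'`, and `ρ(κ)` is a unit or zero of `Γ(D₊(x_j)) ≅ k'[T]`, hence a
constant.  (So `k → k'` is an isomorphism; only the surjectivity onto constants is recorded, in the form BRICK S5b (β)
consumes.)  Helper for stmt-ResolutionOfSingularities-20148 (EL♮(3)) via F-102; no new definitions.
-/

set_option linter.dupNamespace false

noncomputable section

open CategoryTheory AlgebraicGeometry HomogeneousLocalization TopologicalSpace Opposite IsLocalRing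
open MvPolynomial (X C)
open Literature.AlgebraicGeometry.Morphisms Literature.AlgebraicGeometry.Motives Literature.AlgebraicGeometry.Motives.Segre
open Literature.AlgebraicGeometry.Motives.ProjLine
open Summit.ResolutionOfSingularities.ResolutionOfSingularities.Cruxes.EquisingularLiftNat.Sections

universe u

attribute [local instance] MvPolynomial.gradedAlgebra MvPolynomial.algebraMvPolynomial
  Literature.AlgebraicGeometry.Motives.ProjBaseChange.algebraBase

namespace Summit.ResolutionOfSingularities.ResolutionOfSingularities.Cruxes.EquisingularLiftNat.F102

/-- `appLE ⊤ ⊤` of an identity morphism is the identity. [folklore] -/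
theorem appLE_top_top_of_eq_id {X : Scheme.{u}} (m : X ⟶ X) (hm : m = 𝟙 X) (h : (⊤ : X.Opens) ≤ m ⁻¹ᵁ ⊤)
    (a : Γ(X, ⊤)) : m.appLE ⊤ ⊤ h a = a := by
  subst hm
  have h2 : (homOfLE h).op = 𝟙 (op (⊤ : X.Opens)) := Subsingleton.elim _ _
  have h1 : (𝟙 X : X ⟶ X).appLE ⊤ ⊤ h = 𝟙 _ := by
    simp only [Scheme.Hom.appLE, Scheme.Hom.id_app, h2]
    erw [X.presheaf.map_id, Category.comp_id]
  rw [h1]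
  rfl

/-- On `ℙ¹_k`: **the units of `Γ(ℙ¹, D₊(xᵢ)) ≅ k[T]` are the nonzero constants** (and `0` is a constant): an element
that is a unit or zero is `awayToSection (cst c)`. [folklore] -/
theorem ProjLine.exists_eq_awayToSection_cst_of_isUnit_or_zero (k : Type u) [Field k] (i : Fin 2)
    (u : Γ(P k, Proj.basicOpen (A k) (X i))) (hu : IsUnit u ∨ u = 0) :
    ∃ c : k, u = Proj.awayToSection (A k) (X i) (Segre.cst k (X i) c) := by
  rcases hu with hu | rfl
  · set E := (Proj.basicOpenIsoAway (A k) (X i) (Segre.X_mem k i) zero_lt_one).commRingCatIsoToRingEquiv with hEdef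
    have hE : ∀ b, E b = Proj.awayToSection (A k) (X i) b := fun b => by
      change (Proj.basicOpenIsoAway (A k) (X i) (Segre.X_mem k i) zero_lt_one).hom b = _
      rw [Proj.basicOpenIsoAway_hom]
    obtain ⟨b, rfl⟩ := E.surjective u
    have hb : IsUnit b := by simpa only [RingEquiv.symm_apply_apply] using hu.map E.symm
    obtain ⟨r, -, hrC⟩ := Polynomial.isUnit_iff.mp (hb.map (ψ' k i))
    refine ⟨r, ?_⟩
    rw [hE]
    congr 1
    apply (ψ' k i).injective
    rw [← hrC, Polynomial.C_eq_algebraMap, show Segre.cst k (X i) r = algebraMap k (Away (A k) (X i)) r from rfl,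
      AlgEquiv.commutes]
  · exact ⟨0, by rw [map_zero, map_zero]⟩

/-- **BRICK S5b (α′): on the chart `D₊(x_j)` every constant of `k'` is hit by `k` through `e⁻¹ ≫ t`.** [OURS] -/
theorem exists_const_eq_awayToSection_cst (O : Type) [CommRing O] [IsLocalRing O] (k : Type) [Field k]
    (θ : O →+* k) (hθ : Function.Surjective θ) {C Ck : Scheme.{0}} (f : C ⟶ Spec (.of O)) (i : Ck ⟶ C)
    (t : Ck ⟶ Spec (.of k)) (hsq : IsPullback i t f (Spec.map (CommRingCat.ofHom θ))) (k' : Type) [Field k']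
    (e : Ck ≅ ProjCech.PP k' 1) (s : Spec (.of O) ⟶ C) (hs : s ≫ f = 𝟙 _) (j : Fin 2)
    (hz : s.base (closedPoint O) = i.base (e.inv.base (ProjLine.y k' j))) (c' : k') :
    ∃ κ : k, (e.inv ≫ t).appLE ⊤ (Proj.basicOpen (A k') (X j)) le_top ((Scheme.ΓSpecIso (.of k)).inv κ) =
      Proj.awayToSection (A k') (X j) (Segre.cst k' (X j) c') := by
  haveI : IsClosedImmersion (Spec.map (CommRingCat.ofHom θ)) := IsClosedImmersion.spec_of_surjective _ hθ
  haveI : IsClosedImmersion i := MorphismProperty.IsStableUnderBaseChange.of_isPullback hsq.flip inferInstance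
  have hker : RingHom.ker θ = maximalIdeal O :=
    IsLocalRing.eq_maximalIdeal (RingHom.ker_isMaximal_of_surjective θ hθ)
  haveI : IsLocalHom θ := by
    refine ⟨fun a ha => ?_⟩
    by_contra h
    have hmem : a ∈ RingHom.ker θ := by rw [hker]; exact (IsLocalRing.mem_maximalIdeal a).mpr h
    exact ha.ne_zero ((RingHom.mem_ker).mp hmem)
  -- the `k`-rational point `σ` of `C_k` under `s(𝔪)`, read in `ℙ¹_{k'}`
  set σ : Spec (.of k) ⟶ Ck := hsq.lift (Spec.map (CommRingCat.ofHom θ) ≫ s) (𝟙 _)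
    (by rw [Category.assoc, hs, Category.comp_id, Category.id_comp]) with hσ
  have hσi : σ ≫ i = Spec.map (CommRingCat.ofHom θ) ≫ s := hsq.lift_fst _ _ _
  have hσt : σ ≫ t = 𝟙 _ := hsq.lift_snd _ _ _
  set σ' : Spec (.of k) ⟶ ProjCech.PP k' 1 := σ ≫ e.hom with hσ'
  have hpt : ∀ q : Spec (.of k), σ'.base q = y k' j := by
    intro q
    obtain rfl : q = closedPoint k := Subsingleton.elim _ _
    have h1 : i.base (σ.base (closedPoint k)) = i.base (e.inv.base (y k' j)) := by
      rw [← hz]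
      change (σ ≫ i).base (closedPoint k) = _
      rw [hσi]
      exact congrArg s.base (Spec_closedPoint (f := CommRingCat.ofHom θ))
    have h2 : σ.base (closedPoint k) = e.inv.base (y k' j) := i.isClosedEmbedding.injective h1
    rw [hσ']
    change e.hom.base (σ.base (closedPoint k)) = _
    rw [h2]
    change (e.inv ≫ e.hom).base (y k' j) = _
    rw [e.inv_hom_id]
    rfl
  have hle : (⊤ : (Spec (.of k)).Opens) ≤ σ' ⁻¹ᵁ Proj.basicOpen (A k') (X j) := fun q _ => by
    change σ'.base q ∈ Proj.basicOpen (A k') (X j)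
    rw [hpt]
    exact y_mem k' j
  -- evaluation `ev` at `σ'` retracts the constants map `ρ`
  let ev : Γ(ProjCech.PP k' 1, Proj.basicOpen (A k') (X j)) →+* k :=
    (Scheme.ΓSpecIso (.of k)).hom.hom.comp (σ'.appLE (Proj.basicOpen (A k') (X j)) ⊤ hle).hom
  let ρ : k →+* Γ(ProjCech.PP k' 1, Proj.basicOpen (A k') (X j)) :=
    ((e.inv ≫ t).appLE ⊤ (Proj.basicOpen (A k') (X j)) le_top).hom.comp (Scheme.ΓSpecIso (.of k)).inv.hom
  have hm : σ' ≫ e.inv ≫ t = 𝟙 _ := by rw [hσ', Category.assoc, e.hom_inv_id_assoc, hσt]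
  have hevρ : ∀ κ, ev (ρ κ) = κ := fun κ => by
    change (Scheme.ΓSpecIso (.of k)).hom ((σ'.appLE (Proj.basicOpen (A k') (X j)) ⊤ hle)
      (((e.inv ≫ t).appLE ⊤ (Proj.basicOpen (A k') (X j)) le_top) ((Scheme.ΓSpecIso (.of k)).inv κ))) = κ
    rw [← CommRingCat.comp_apply ((e.inv ≫ t).appLE ⊤ _ le_top) (σ'.appLE _ ⊤ hle), Scheme.Hom.appLE_comp_appLE,
      appLE_top_top_of_eq_id _ hm, ← CommRingCat.comp_apply, Iso.inv_hom_id]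
    rfl
  have hinj : Function.Injective (fun c : k' => ev (Proj.awayToSection (A k') (X j) (Segre.cst k' (X j) c))) :=
    (ev.comp ((Proj.awayToSection (A k') (X j)).hom.comp (Segre.cst k' (X j)))).injective
  have hρu : ∀ κ, IsUnit (ρ κ) ∨ ρ κ = 0 := fun κ => by
    by_cases hκ : κ = 0
    · exact Or.inr (by rw [hκ, map_zero])
    · exact Or.inl ((IsUnit.mk0 κ hκ).map ρ)
  -- assemble
  obtain ⟨c'', hc''⟩ := ProjLine.exists_eq_awayToSection_cst_of_isUnit_or_zero k' j
    (ρ (ev (Proj.awayToSection (A k') (X j) (Segre.cst k' (X j) c'))))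
    (hρu _)
  have hcc : c'' = c' := hinj (by
    change ev (Proj.awayToSection (A k') (X j) (Segre.cst k' (X j) c'')) =
      ev (Proj.awayToSection (A k') (X j) (Segre.cst k' (X j) c'))
    rw [← hc'', hevρ])
  refine ⟨ev (Proj.awayToSection (A k') (X j) (Segre.cst k' (X j) c')), ?_⟩
  change ρ (ev (Proj.awayToSection (A k') (X j) (Segre.cst k' (X j) c'))) = _
  rw [hc'', hcc]

end Summit.ResolutionOfSingularities.ResolutionOfSingularities.Cruxes.EquisingularLiftNat.F102

end
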